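import Summits.NavierStokesRegularity.OSWSelfSimilar.SheetRCayleySubstitution
import Literature.Analysis.Fourier.FourierPartialSumDerivBound
import HarnessLib

/-!
# SHEET-ℝ frame: the output high-pass projection in the Cayley chart (frame side of PRICE-impl1 (E5))

HONEST FRAMING (cell ns-blowup GROUP B / zone Z3, case Z3-SR-CERT; 1-D MODEL certificate frame; not Euler/NS).

In the frame of `SheetRCayleySubstitution` (`ξ = L tan(θ/2)`, weight `w = L² + ξ²`, frame functions
`e_n = (1 + cos θ) sin nθ`, `‖e_n‖²_w = 2L³π`, `⟨φ, e_n⟩_w = 2L³∫_{(−π,π)} g_φ sin nθ dθ` with `g_φ := (φ∘Φ)/(1 + cos θ)`), the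
`w`-orthogonal projection `Π_T = 1 − Π_H` onto `{φ : ⟨φ, e_n⟩_w = 0, n ≤ N}` acts on `g_φ` as the removal of the first `N` sine modes.
This file records the DICTIONARY half of the price memo's output high-pass lemma (E5):

* `integral_weight_mul_sub_frameSum_sq_comp_cayley` — for ANY coefficients `c_1, …, c_N`,
  `‖ψ − Σ_{n≤N} c_n e_n‖²_w = 2L³ · ∫_{(−π,π)} (g_ψ(θ) − Σ_{n≤N} c_n sin nθ)² dθ`;
* `frameCoeff_eq` — the `Π_H` coefficients `⟨ψ, e_n⟩_w/(2L³π)` ARE the sine coefficients `π⁻¹∫_{(−π,π)} g_ψ sin nθ` of `g_ψ`;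
so that `‖Π_T ψ‖_w = (2L³)^{1/2}·‖g_ψ − S_N g_ψ‖_{L²(−π,π)}` with `S_N` the sine partial sum;
* the ODD-REAL BRIDGE to the tree's complex-exponential partial sums: for odd continuous real `g` on `[−π, π]` the
  Fourier coefficients are `ĝ(m) = −(i/2π)∫_{−π}^{π} g sin mθ` (`fourierCoeffOn_ofReal_of_odd`) and the symmetric partial sum
  `Σ_{|m|≤N} ĝ(m)e^{imθ}` IS the sine partial sum `Σ_{n≤N} (π⁻¹∫ g sin nθ) sin nθ` (`fourierSum_ofReal_of_odd`);
* **(E5) `highPass_weightedSq_le`**: if `ψ(Φ θ) = (1 + cos θ)·g(θ)` on `(−π, π)` for an odd `C¹` function `g` with `g(π) = 0`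
  (i.e. `g_ψ ∈ H¹(𝕋)`), then `‖ψ − Σ_{n≤N} b_n e_n‖²_w ≤ 2L³/(N + 1)² · ∫_{−π}^{π} g′²` with `b_n = π⁻¹∫_{−π}^{π} g sin nθ`
  `= ⟨ψ, e_n⟩_w/(2L³π)` (`frameCoeff_eq_sineCoeff`) — i.e. `‖Π_T ψ‖_w ≤ (2L³)^{1/2}‖∂_θ g_ψ‖_{L²(dθ)}/(N + 1)`, the price memo's
  (E5), obtained from the generic tail inequality `Literature.Analysis.Fourier.intervalIntegral_norm_sub_fourierSum_sq_le`
  (cert-2 lineage, Canuto–Hussaini–Quarteroni–Zang (5.1.9)) read through this dictionary.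
Pure calculus; no definition, no named fact; MODEL frame bookkeeping only.
-/

noncomputable section

namespace Summit.NavierStokesRegularity.OSWSelfSimilar
namespace SheetRHighPass

open _root_.MeasureTheory _root_.Set _root_.Filter _root_.Real
open scoped Real Topology
open SheetRCayleySubstitution

/-- A finite frame sum in the chart: `Σ c_n e_n(Φ θ) = (1 + cos θ)·Σ c_n sin nθ` on `(−π, π)`. [folklore] -/
theorem frameSum_cayley {L : ℝ} (hL : L ≠ 0) (c : ℕ → ℝ) (s : Finset ℕ) {θ : ℝ} (hθ : θ ∈ Ioo (-π) π) :
    ∑ n ∈ s, c n * ((1 + cos (2 * arctan (L * tan (θ / 2) / L))) * sin (n * (2 * arctan (L * tan (θ / 2) / L)))) =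
      (1 + cos θ) * ∑ n ∈ s, c n * sin (n * θ) := by
  simp only [cayleyAngle_cayley hL hθ]
  rw [Finset.mul_sum]
  refine Finset.sum_congr rfl fun n _ => ?_
  ring

/-- **(E5), dictionary half.** For any `ψ : ℝ → ℝ`, any finite set of modes `s` and coefficients `c`:
`‖ψ − Σ_{n∈s} c_n e_n‖²_w = ∫(L² + ξ²)(ψ − Σ c_n e_n)² dξ = 2L³·∫_{(−π,π)} (ψ(L tan(θ/2))/(1 + cos θ) − Σ_{n∈s} c_n sin nθ)² dθ`
— in the chart, subtracting a frame sum from `ψ` subtracts the sine polynomial with the same coefficients from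
`g_ψ = (ψ∘Φ)/(1 + cos θ)`. [folklore] -/
theorem integral_weight_mul_sub_frameSum_sq_comp_cayley {L : ℝ} (hL : 0 < L) (ψ : ℝ → ℝ) (c : ℕ → ℝ)
    (s : Finset ℕ) :
    ∫ ξ, (L ^ 2 + ξ ^ 2) *
        (ψ ξ - ∑ n ∈ s, c n * ((1 + cos (2 * arctan (ξ / L))) * sin (n * (2 * arctan (ξ / L))))) ^ 2 =
      2 * L ^ 3 * ∫ θ in Ioo (-π) π, (ψ (L * tan (θ / 2)) / (1 + cos θ) - ∑ n ∈ s, c n * sin (n * θ)) ^ 2 := by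
  rw [integral_weight_mul_sq_comp_cayley hL]
  congr 1
  refine setIntegral_congr_fun measurableSet_Ioo fun θ hθ => ?_
  have h1 : (1 + cos θ) ≠ 0 := (one_add_cos_pos hθ).ne'
  simp only [frameSum_cayley hL.ne' c s hθ]
  field_simp

/-- The same with the modes `1 ≤ n ≤ N` (the head `Π_H`-range of the certificate frame). [folklore] -/
theorem integral_weight_mul_sub_frameSum_Icc_sq_comp_cayley {L : ℝ} (hL : 0 < L) (ψ : ℝ → ℝ) (c : ℕ → ℝ) (N : ℕ) :
    ∫ ξ, (L ^ 2 + ξ ^ 2) *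
        (ψ ξ - ∑ n ∈ Finset.Icc 1 N, c n * ((1 + cos (2 * arctan (ξ / L))) * sin (n * (2 * arctan (ξ / L))))) ^ 2 =
      2 * L ^ 3 * ∫ θ in Ioo (-π) π,
        (ψ (L * tan (θ / 2)) / (1 + cos θ) - ∑ n ∈ Finset.Icc 1 N, c n * sin (n * θ)) ^ 2 :=
  integral_weight_mul_sub_frameSum_sq_comp_cayley hL ψ c _

/-- **The `Π_H` coefficients are sine coefficients.** `⟨ψ, e_n⟩_w/(2L³π) = π⁻¹·∫_{(−π,π)} (ψ(L tan(θ/2))/(1 + cos θ))·sin nθ dθ`: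
the coefficient of `e_n` in the `w`-orthogonal projection of `ψ` onto `span{e_1, …, e_N}` (`‖e_n‖²_w = 2L³π`,
`SheetRCayleySubstitution.frame_weightedSq`) is the `n`-th sine coefficient of `g_ψ = (ψ∘Φ)/(1 + cos θ)`. [folklore] -/
theorem frameCoeff_eq {L : ℝ} (hL : 0 < L) (ψ : ℝ → ℝ) (n : ℕ) :
    (∫ ξ, (L ^ 2 + ξ ^ 2) * (ψ ξ * ((1 + cos (2 * arctan (ξ / L))) * sin (n * (2 * arctan (ξ / L)))))) /
        (2 * L ^ 3 * π) =
      π⁻¹ * ∫ θ in Ioo (-π) π, ψ (L * tan (θ / 2)) / (1 + cos θ) * sin (n * θ) := by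
  rw [integral_weight_mul_frame_comp_cayley hL]
  have hL3 : 2 * L ^ 3 ≠ 0 := by positivity
  rw [mul_comm (2 * L ^ 3) π, ← div_div, mul_div_assoc, mul_div_cancel_left₀ _ hL3]
  rw [div_eq_inv_mul]
  congr 1
  refine setIntegral_congr_fun measurableSet_Ioo fun θ _ => ?_
  ring

/-! ### The odd-real bridge: Fourier coefficients and symmetric partial sums of an odd real function on `[−π, π]` -/

/-- The integral of an odd function over `[−a, a]` vanishes. [folklore] -/
theorem intervalIntegral_eq_zero_of_odd {h : ℝ → ℝ} (hodd : ∀ x, h (-x) = -h x) (a : ℝ) :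
    ∫ x in -a..a, h x = 0 := by
  have h1 : ∫ x in -a..a, h (-x) = ∫ x in -a..a, h x := by
    rw [intervalIntegral.integral_comp_neg]; simp
  have h2 : ∫ x in -a..a, h (-x) = -∫ x in -a..a, h x := by
    simp_rw [hodd]; exact intervalIntegral.integral_neg
  linarith

/-- The characters of period `2π` on the window `[−π, π]`: `e_m(x) = cos mx + i sin mx`. [folklore] -/
theorem fourier_coe_two_pi (m : ℤ) (x : ℝ) :
    fourier m (x : AddCircle (π - -π)) = (Real.cos (m * x) : ℂ) + (Real.sin (m * x) : ℂ) * Complex.I := by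
  rw [fourier_coe_apply]
  have h2 : ((π - -π : ℝ) : ℂ) = 2 * π := by push_cast; ring
  have hπ' : (π : ℂ) ≠ 0 := Complex.ofReal_ne_zero.2 pi_ne_zero
  have : (2 * π * Complex.I * m * x / ((π - -π : ℝ) : ℂ) : ℂ) = ((m * x : ℝ) : ℂ) * Complex.I := by
    rw [h2]
    push_cast
    field_simp
  rw [this, Complex.exp_mul_I, ← Complex.ofReal_cos, ← Complex.ofReal_sin]

/-- **Fourier coefficients of an odd real function on `[−π, π]`**: `ĝ(m) = −(i/(2π))·∫_{−π}^{π} g(x) sin(mx) dx`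
(the cosine part vanishes by oddness). [folklore] -/
theorem fourierCoeffOn_ofReal_of_odd {g : ℝ → ℝ} (hg : Continuous g) (hodd : ∀ x, g (-x) = -g x) (m : ℤ) :
    fourierCoeffOn (by linarith [pi_pos] : -π < π) (fun x => (g x : ℂ)) m =
      -(Complex.I / (2 * π)) * ((∫ x in -π..π, g x * Real.sin (m * x) : ℝ) : ℂ) := by
  rw [fourierCoeffOn_eq_integral]
  have hint : (∫ x in -π..π, fourier (-m) (x : AddCircle (π - -π)) • (g x : ℂ)) =
      ((∫ x in -π..π, g x * Real.cos (m * x) : ℝ) : ℂ) -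
        Complex.I * ((∫ x in -π..π, g x * Real.sin (m * x) : ℝ) : ℂ) := by
    have h1 : ∀ x : ℝ, fourier (-m) (x : AddCircle (π - -π)) • (g x : ℂ) =
        ((g x * Real.cos (m * x) : ℝ) : ℂ) - Complex.I * ((g x * Real.sin (m * x) : ℝ) : ℂ) := by
      intro x
      rw [fourier_coe_two_pi, smul_eq_mul]
      simp only [Int.cast_neg, neg_mul, Real.cos_neg, Real.sin_neg, Complex.ofReal_neg]
      push_cast
      ring
    simp_rw [h1]
    rw [intervalIntegral.integral_sub ((by fun_prop : Continuous fun x : ℝ =>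
        ((g x * Real.cos (m * x) : ℝ) : ℂ)).intervalIntegrable _ _)
      ((by fun_prop : Continuous fun x : ℝ =>
        Complex.I * ((g x * Real.sin (m * x) : ℝ) : ℂ)).intervalIntegrable _ _),
      intervalIntegral.integral_const_mul, intervalIntegral.integral_ofReal, intervalIntegral.integral_ofReal]
  have hcos : ∫ x in -π..π, g x * Real.cos (m * x) = 0 :=
    intervalIntegral_eq_zero_of_odd (fun x => by
      rw [hodd, show (m : ℝ) * -x = -(m * x) by ring, Real.cos_neg]; ring) π
  rw [hint, hcos, Complex.real_smul]
  have hπ' : (π : ℂ) ≠ 0 := Complex.ofReal_ne_zero.2 pi_ne_zero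
  push_cast
  rw [show ((π : ℂ) - -π) = 2 * π by ring]
  field_simp
  ring

/-- A symmetric integer window splits into `0` and the pairs `±n`, `1 ≤ n ≤ N`. [folklore] -/
theorem sum_Icc_neg_eq {M : Type*} [AddCommMonoid M] (F : ℤ → M) (N : ℕ) :
    ∑ m ∈ Finset.Icc (-(N : ℤ)) N, F m = F 0 + ∑ n ∈ Finset.Icc 1 N, (F n + F (-(n : ℤ))) := by
  induction N with
  | zero => simp
  | succ N ih =>
    have hset : Finset.Icc (-((N + 1 : ℕ) : ℤ)) ((N + 1 : ℕ) : ℤ) =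
        insert (-((N + 1 : ℕ) : ℤ)) (insert (((N + 1 : ℕ) : ℤ)) (Finset.Icc (-(N : ℤ)) N)) := by
      ext m
      simp only [Finset.mem_Icc, Finset.mem_insert]
      push_cast
      omega
    have h1 : ((N + 1 : ℕ) : ℤ) ∉ Finset.Icc (-(N : ℤ)) N := by simp
    have h2 : -((N + 1 : ℕ) : ℤ) ∉ insert (((N + 1 : ℕ) : ℤ)) (Finset.Icc (-(N : ℤ)) N) := by
      simp only [Finset.mem_insert, Finset.mem_Icc]; push_cast; omega
    rw [hset, Finset.sum_insert h2, Finset.sum_insert h1, ih, Finset.sum_Icc_succ_top (by omega)]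
    abel

/-- **Symmetric exponential partial sum of an odd real function = sine partial sum**: for odd continuous `g` on `[−π, π]`,
`Σ_{|m| ≤ N} ĝ(m) e^{imθ} = Σ_{1 ≤ n ≤ N} b_n sin nθ`, `b_n = π⁻¹∫_{−π}^{π} g(x) sin(nx) dx`. [folklore] -/
theorem fourierSum_ofReal_of_odd {g : ℝ → ℝ} (hg : Continuous g) (hodd : ∀ x, g (-x) = -g x) (N : ℕ) (θ : ℝ) :
    ∑ m ∈ Finset.Icc (-(N : ℤ)) N,
        fourierCoeffOn (by linarith [pi_pos] : -π < π) (fun x => (g x : ℂ)) m * fourier m (θ : AddCircle (π - -π)) =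
      ((∑ n ∈ Finset.Icc 1 N, (π⁻¹ * ∫ x in -π..π, g x * Real.sin (n * x)) * Real.sin (n * θ) : ℝ) : ℂ) := by
  rw [sum_Icc_neg_eq]
  have h0 : fourierCoeffOn (by linarith [pi_pos] : -π < π) (fun x => (g x : ℂ)) 0 *
      fourier 0 (θ : AddCircle (π - -π)) = 0 := by
    rw [fourierCoeffOn_ofReal_of_odd hg hodd 0]
    simp
  rw [h0, zero_add, Complex.ofReal_sum]
  refine Finset.sum_congr rfl fun n _ => ?_
  rw [fourierCoeffOn_ofReal_of_odd hg hodd n, fourierCoeffOn_ofReal_of_odd hg hodd (-(n : ℤ)),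
    fourier_coe_two_pi, fourier_coe_two_pi]
  simp only [Int.cast_neg, Int.cast_natCast, neg_mul, Real.cos_neg, Real.sin_neg, mul_neg,
    intervalIntegral.integral_neg, Complex.ofReal_neg]
  set S : ℂ := ((∫ x in -π..π, g x * Real.sin (n * x) : ℝ) : ℂ) with hS
  set c : ℂ := ((Real.cos (n * θ) : ℝ) : ℂ) with hc
  set sn : ℂ := ((Real.sin (n * θ) : ℝ) : ℂ) with hsn
  have hπ' : (π : ℂ) ≠ 0 := Complex.ofReal_ne_zero.2 pi_ne_zero
  have hrhs : (((π⁻¹ * ∫ x in -π..π, g x * Real.sin (n * x)) * Real.sin (n * θ) : ℝ) : ℂ) = (π : ℂ)⁻¹ * S * sn := by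
    rw [hS, hsn]; push_cast; ring
  rw [hrhs]
  field_simp
  linear_combination (-(2:ℂ) * S * sn) * Complex.I_mul_I

/-! ### (E5): the output high-pass bound in the frame -/

/-- Under the chart relation `ψ(Φ θ) = (1 + cos θ)·g(θ)` on `(−π, π)`, the `Π_H` coefficient `⟨ψ, e_n⟩_w/(2L³π)` is the sine
coefficient `b_n = π⁻¹∫_{−π}^{π} g sin nθ` of `g`. [folklore] -/
theorem frameCoeff_eq_sineCoeff {L : ℝ} (hL : 0 < L) {ψ g : ℝ → ℝ}
    (hψ : ∀ θ ∈ Ioo (-π) π, ψ (L * tan (θ / 2)) = (1 + cos θ) * g θ) (n : ℕ) :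
    (∫ ξ, (L ^ 2 + ξ ^ 2) * (ψ ξ * ((1 + cos (2 * arctan (ξ / L))) * sin (n * (2 * arctan (ξ / L)))))) /
        (2 * L ^ 3 * π) =
      π⁻¹ * ∫ θ in -π..π, g θ * sin (n * θ) := by
  rw [frameCoeff_eq hL, intervalIntegral.integral_of_le (by linarith [pi_pos]), integral_Ioc_eq_integral_Ioo]
  congr 1
  refine setIntegral_congr_fun measurableSet_Ioo fun θ hθ => ?_
  have h1 : (1 + cos θ) ≠ 0 := (one_add_cos_pos hθ).ne'
  rw [hψ θ hθ, mul_div_cancel_left₀ _ h1]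

/-- **(E5) OUTPUT HIGH-PASS LEMMA, frame form.** Let `L > 0`, `ψ : ℝ → ℝ`, and suppose `ψ(L tan(θ/2)) = (1 + cos θ)·g(θ)` on
`(−π, π)` for an ODD real function `g` with continuous derivative `g′` on `ℝ` and `g(π) = 0` (so `g_ψ = (ψ∘Φ)/(1 + cos θ)` extends to
an odd `2π`-periodic `H¹` function). Then for every `N`, with `b_n = π⁻¹∫_{−π}^{π} g sin nθ` (`= ⟨ψ, e_n⟩_w/(2L³π)`,
`frameCoeff_eq_sineCoeff`):
`‖ψ − Σ_{n≤N} b_n e_n‖²_w = ∫(L² + ξ²)(ψ − Σ_{n≤N} b_n e_n)² dξ ≤ (2L³/(N + 1)²)·∫_{−π}^{π} g′(θ)² dθ`,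
i.e. `‖Π_T ψ‖_w ≤ (2L³)^{1/2}‖∂_θ g_ψ‖_{L²(dθ)}/(N + 1)` (PRICE-impl1 §1 (E5) with `Π_T` the `w`-orthogonal projection onto
`{⟨·, e_n⟩_w = 0, n ≤ N}`). Composition of the dictionary `integral_weight_mul_sub_frameSum_sq_comp_cayley`, the odd-real bridge
`fourierSum_ofReal_of_odd`, and the generic tail inequality `Literature.Analysis.Fourier.intervalIntegral_norm_sub_fourierSum_sq_le`.
[folklore] -/
theorem highPass_weightedSq_le {L : ℝ} (hL : 0 < L) {ψ g g' : ℝ → ℝ} (hg : ∀ θ, HasDerivAt g (g' θ) θ)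
    (hg' : Continuous g') (hodd : ∀ θ, g (-θ) = -g θ) (hπ0 : g π = 0)
    (hψ : ∀ θ ∈ Ioo (-π) π, ψ (L * tan (θ / 2)) = (1 + cos θ) * g θ) (N : ℕ) :
    ∫ ξ, (L ^ 2 + ξ ^ 2) *
        (ψ ξ - ∑ n ∈ Finset.Icc 1 N, (π⁻¹ * ∫ θ in -π..π, g θ * sin (n * θ)) *
          ((1 + cos (2 * arctan (ξ / L))) * sin (n * (2 * arctan (ξ / L))))) ^ 2 ≤
      2 * L ^ 3 / (N + 1) ^ 2 * ∫ θ in -π..π, g' θ ^ 2 := by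
  have hgc : Continuous g := continuous_iff_continuousAt.2 fun x => (hg x).continuousAt
  have hππ : (-π : ℝ) < π := by linarith [pi_pos]
  -- Step 1: the dictionary
  rw [integral_weight_mul_sub_frameSum_sq_comp_cayley hL]
  have hchart : (∫ θ in Ioo (-π) π, (ψ (L * tan (θ / 2)) / (1 + cos θ) -
        ∑ n ∈ Finset.Icc 1 N, (π⁻¹ * ∫ θ in -π..π, g θ * sin (n * θ)) * sin (n * θ)) ^ 2) =
      ∫ θ in -π..π, (g θ - ∑ n ∈ Finset.Icc 1 N, (π⁻¹ * ∫ x in -π..π, g x * sin (n * x)) * sin (n * θ)) ^ 2 := by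
    rw [intervalIntegral.integral_of_le hππ.le, integral_Ioc_eq_integral_Ioo]
    refine setIntegral_congr_fun measurableSet_Ioo fun θ hθ => ?_
    have h1 : (1 + cos θ) ≠ 0 := (one_add_cos_pos hθ).ne'
    rw [hψ θ hθ, mul_div_cancel_left₀ _ h1]
  rw [hchart]
  -- Step 2: the generic tail inequality for `G = (g : ℂ)` on `[−π, π]`, read through the odd-real bridge
  have hG : ∀ x, HasDerivAt (fun x => (g x : ℂ)) ((g' x : ℂ)) x := fun x => (hg x).ofReal_comp
  have hG' : Continuous fun x => (g' x : ℂ) := Complex.continuous_ofReal.comp hg'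
  have hper : (fun x => (g x : ℂ)) π = (fun x => (g x : ℂ)) (-π) := by
    simp only [hodd, hπ0, neg_zero]
  have htail := Literature.Analysis.Fourier.intervalIntegral_norm_sub_fourierSum_sq_le hππ hG hG' hper N
  have hlhs : (∫ x in -π..π, ‖(g x : ℂ) - ∑ n ∈ Finset.Icc (-(N : ℤ)) N,
        fourierCoeffOn hππ (fun x => (g x : ℂ)) n * fourier n (x : AddCircle (π - -π))‖ ^ 2) =
      ∫ θ in -π..π, (g θ - ∑ n ∈ Finset.Icc 1 N, (π⁻¹ * ∫ x in -π..π, g x * sin (n * x)) * sin (n * θ)) ^ 2 := by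
    refine intervalIntegral.integral_congr fun θ _ => ?_
    rw [fourierSum_ofReal_of_odd hgc hodd N θ, ← Complex.ofReal_sub, Complex.norm_real, Real.norm_eq_abs, sq_abs]
  have hrhs : (∫ x in -π..π, ‖(g' x : ℂ)‖ ^ 2) = ∫ θ in -π..π, g' θ ^ 2 := by
    refine intervalIntegral.integral_congr fun θ _ => ?_
    rw [Complex.norm_real, Real.norm_eq_abs, sq_abs]
  rw [hlhs, hrhs] at htail
  have hK : ((π - -π) / (2 * π * (N + 1))) ^ 2 = 1 / (N + 1) ^ 2 := by
    have hπ1 : (π : ℝ) ≠ 0 := pi_ne_zero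
    field_simp
    ring
  rw [hK] at htail
  have hL3 : 0 ≤ 2 * L ^ 3 := by positivity
  calc 2 * L ^ 3 * ∫ θ in -π..π, (g θ - ∑ n ∈ Finset.Icc 1 N, (π⁻¹ * ∫ x in -π..π, g x * sin (n * x)) * sin (n * θ)) ^ 2
      ≤ 2 * L ^ 3 * (1 / (N + 1) ^ 2 * ∫ θ in -π..π, g' θ ^ 2) := mul_le_mul_of_nonneg_left htail hL3
    _ = 2 * L ^ 3 / (N + 1) ^ 2 * ∫ θ in -π..π, g' θ ^ 2 := by ring

/-- **(E5) with the `Π_H` coefficients written literally**: under the hypotheses of `highPass_weightedSq_le`, with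
`Π_H ψ := Σ_{n≤N} (⟨ψ, e_n⟩_w/(2L³π))·e_n` (the `w`-orthogonal projection onto `span{e_1,…,e_N}`, `‖e_n‖²_w = 2L³π`) and
`Π_T ψ := ψ − Π_H ψ`: `‖Π_T ψ‖²_w = ∫(L² + ξ²)(ψ − Π_H ψ)² dξ ≤ (2L³/(N + 1)²)·∫_{−π}^{π} g′²` — PRICE-impl1 §1 (E5) verbatim
(`‖Π_T ψ‖_w ≤ (2L³)^{1/2}‖∂_θ g_ψ‖_{L²(dθ)}/(N + 1)`). [folklore] -/
theorem highPass_weightedSq_le_frameCoeff {L : ℝ} (hL : 0 < L) {ψ g g' : ℝ → ℝ} (hg : ∀ θ, HasDerivAt g (g' θ) θ)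
    (hg' : Continuous g') (hodd : ∀ θ, g (-θ) = -g θ) (hπ0 : g π = 0)
    (hψ : ∀ θ ∈ Ioo (-π) π, ψ (L * tan (θ / 2)) = (1 + cos θ) * g θ) (N : ℕ) :
    ∫ ξ, (L ^ 2 + ξ ^ 2) *
        (ψ ξ - ∑ n ∈ Finset.Icc 1 N,
          (∫ ζ, (L ^ 2 + ζ ^ 2) * (ψ ζ * ((1 + cos (2 * arctan (ζ / L))) * sin (n * (2 * arctan (ζ / L)))))) /
              (2 * L ^ 3 * π) *
            ((1 + cos (2 * arctan (ξ / L))) * sin (n * (2 * arctan (ξ / L))))) ^ 2 ≤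
      2 * L ^ 3 / (N + 1) ^ 2 * ∫ θ in -π..π, g' θ ^ 2 := by
  have hcoef : ∀ n : ℕ,
      (∫ ζ, (L ^ 2 + ζ ^ 2) * (ψ ζ * ((1 + cos (2 * arctan (ζ / L))) * sin (n * (2 * arctan (ζ / L)))))) /
          (2 * L ^ 3 * π) =
        π⁻¹ * ∫ θ in -π..π, g θ * sin (n * θ) := fun n => frameCoeff_eq_sineCoeff hL hψ n
  simp only [hcoef]
  exact highPass_weightedSq_le hL hg hg' hodd hπ0 hψ N

end SheetRHighPass
end Summit.NavierStokesRegularity.OSWSelfSimilar
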